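import Literature.NumberTheory.EllipticCurves.HeegnerPointsOfConductorGaloisConj
import Literature.NumberTheory.EllipticCurves.BSDHeegnerPoints
import Literature.NumberTheory.EllipticCurves.BSDHeegnerPointsModularityOnlyProofs
import Literature.NumberTheory.EllipticCurves.AnalyticRankModularityProofs
import Literature.NumberTheory.EllipticCurves.LeadingTermProofs
import HarnessLib

/-!
# BirchSwinnertonDyer / SelmerRank — crux `SelmerRankLB` (stmt-BirchSwinnertonDyer-0131),
# line `heegner_order`, stub **HG** `stub_heegner_bottom_torsion`: closure modulo Gross–Zagier
# and Shimura reciprocity at conductor `1`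

Registered stub **HG** of the skeleton `Cruxes/SelmerRankLB/Lines/heegner_order.lean` (the
BOTTOM of Kolyvagin's Heegner system): for a globally minimal elliptic `W/ℚ`, a prime `p ≥ 5` of
good ordinary reduction with `ρ̄_{E,p}` surjective, an imaginary quadratic `K` with the Heegner
hypothesis for `N_E` (`d_K ∉ {−3, −4}`, `p ∤ d_K`), if `r_an(E) + r_an(E^{(d_K)}) ≥ 2` then for
every modular parametrisation datum `Dt`, orientation `β`, embedding `ι`, Kolyvagin–Heegner datum
`d` of conductor `1` and level `M`, the class `c_M(1) = d.kolyvaginClass hp.out M ∈ H¹(K, E[p^M])`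
(`KolyvaginHeegnerData.kolyvaginClass`, file `HeegnerPointsOfConductor`) vanishes.

In print (Gross 1991, §4; W. Zhang 2014, proof of Thm. 1.3, p. 196): `c_M(1)` is McCallum's class
of `P(1) = Σ_{σ ∈ S} σ y(1) = Tr_{K[1]/K} y(1) = y_K` (Gross (4.1) and the remark after it; tree
`KolyvaginHeegnerData.derivedPoint_one`); `y_K` is the Heegner point of the Gross–Zagier formula, so
`ord_{s=1} L(E/K, s) = r_an(E) + r_an(E^{(d_K)}) ≠ 1` makes it TORSION (Gross–Zagier 1986,
Thm. I.6.3 with V.§2; Gross 1991, (1.1)); and a torsion point of a subgroup `A = E(K[1]) ⊆ E(K̄)` on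
which `[p^M]` is injective (the admissibility built into `kolyvaginClass`, Gross Lemma 4.3) is
`p^M`-divisible in `A`, so its class is `0` (Gross, Prop. 4.7 (1); McCallum, Cor. 4.5; tree
`KolyvaginCocycle.cls_eq_zero_of_mem`). Off the admissible branch the tree's total `kolyvaginClass`
is `0` by definition.

The three inputs that are NOT theorems of the tree are taken as hypotheses, so the stub is closed
here RELATIVE to:

* `Literature.NumberTheory.EllipticCurves.analyticRankEK_eq_add W K` (`BSDHeegnerPoints`, named
  fact): `ord_{s=1} L(E/K, s) = r_an(E) + r_an(E^{(d_K)})` (Gross–Zagier 1986, I.§7; in the tree a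
  consequence of the Modularity theorem, `analyticRankEK_eq_add_of`);
* `Literature.NumberTheory.EllipticCurves.analyticRankEK_eq_one_iff_heegner_nonTorsion W N K`
  (`BSDHeegnerPoints`, named fact): for a Heegner point `P_K ∈ E(K)` of level `N = N_E`,
  `ord_{s=1} L(E/K, s) = 1 ↔ P_K` has infinite order (Gross–Zagier 1986, Thm. I.6.3 with V.§2; in
  the tree a consequence of `gross_zagier` and modularity,
  `analyticRankEK_eq_one_iff_heegner_nonTorsion_of_exists_isNewformOf`);
* `Literature.NumberTheory.EllipticCurves.heegnerPointOfConductor_one_galoisConj N W K`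
  (`HeegnerPointsOfConductorGaloisConj`, named fact minted for this stub, p164578): Shimura
  reciprocity for the Heegner point of conductor `1` — the `Gal(K[1]/K)`-conjugates of
  `y(1) = φ(x(1))` are the
  `h_K` Heegner points `φ(τ_Q)`, `[Q]` running once over the `Γ₀(N)`-classes of Heegner forms of
  discriminant `d_K` with `B ≡ β (mod 2N)` (Darmon 2004, Thm. 3.7 with Gross 1984, §I.1; it is the
  identity `P_1 = Tr_{K_1/K} y_1 = y_K` of Gross 1991, §4, between Kolyvagin's bottom point and the
  Gross–Zagier point). This is the glue between the tree's two Heegner vocabularies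
  (`KolyvaginHeegnerData.y/derivedPoint` of `HeegnerPointsOfConductor` and
  `heegnerPointComplex`/`IsHeegnerPoint` of `HeegnerPoints`); the CM theory it needs (Artin map,
  main theorem of complex multiplication) is not in Mathlib, exactly as for the tree's sibling fact
  `heegnerPoints_galoisConj` (which records only that `Gal` PERMUTES the `φ(τ_Q)`).

Everything else is PROVED here: `S = Gal(K[1]/K)` at conductor `1` (`G_1 = 1`), the
`Gal(K[1]/K)`-invariance of `P(1)` and its Galois descent to `E(K)` (via the tree's
`exists_map_eq_of_forall_map_galois_eq` and `finiteDimensional_and_isGalois_ringClassField`), the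
identification of the descended point as a Heegner point of level `N_E` (`IsHeegnerPoint`, using
the proved `exists_heegnerDatum`), transport of torsion along `E(K) → E(K[1]) → E(K̄)`, the
divisibility of torsion points in an admissible subgroup, and the vanishing of McCallum's class.

* `stub_heegner_bottom_torsion_of_facts` — the registered signature verbatim behind the three
  hypotheses (∀-closed). CONDITIONAL; it does not close the stub.
* `stub_heegner_bottom_torsion_of_modularity` — the same behind `exists_isNewformOf` (Modularity,
  BCDT 2001 Thm. A), `gross_zagier` (the Gross–Zagier formula) and the reciprocity fact, through the
  tree's proved reductions of the first two facts above.

Hypotheses of the stub that are unused, as in print: minimality is used only through the GZ fact;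
`p ≥ 5`, good ordinary reduction, surjectivity of `ρ̄`, `d_K ∉ {−3, −4}`, `p ∤ d_K` are not needed
(`E(K[1])[p^M] = 0` is only used inside the admissible branch, where it is given).
-/

set_option linter.dupNamespace false

noncomputable section

open scoped Classical

universe u

namespace Summit.BirchSwinnertonDyer.BirchSwinnertonDyer.Theorems

open Literature.NumberTheory.EllipticCurves Literature.NumberTheory.EllipticCurves.ModularForms

/-! ### Divisibility of torsion points in an admissible subgroup -/

/-- In a subgroup `A` on which multiplication by `n` is injective, every torsion point `P ∈ A` is
`n`-divisible inside `A`: `[n]` is an injective self-map of the finite cyclic group `ℤP ≤ A`, hence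
onto (the step "`y_K` torsion and `E(K)[p] = 0` ⇒ `y_K ∈ p^M E(K)`" of W. Zhang 2014, proof of
Thm. 1.3). [folklore] -/
theorem bottomTorsion_exists_zsmul_eq {M : Type*} [AddCommGroup M] {A : AddSubgroup M} {n : ℤ}
    (hAn : ∀ ⦃a : M⦄, a ∈ A → n • a = 0 → a = 0) {P : M} (hPA : P ∈ A)
    (hP : IsOfFinAddOrder P) : ∃ B ∈ A, n • B = P := by
  have hle : AddSubgroup.zmultiples P ≤ A := AddSubgroup.zmultiples_le.mpr hPA
  haveI : Finite (AddSubgroup.zmultiples P) := hP.finite_zmultiples.to_subtype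
  let f : AddSubgroup.zmultiples P → AddSubgroup.zmultiples P :=
    fun x ↦ ⟨n • (x : M), AddSubgroup.zsmul_mem _ x.2 n⟩
  have hinj : Function.Injective f := by
    intro x y hxy
    apply Subtype.ext
    have h : n • ((x : M) - y) = 0 := by
      rw [zsmul_sub, sub_eq_zero]
      exact congrArg Subtype.val hxy
    exact sub_eq_zero.mp (hAn (A.sub_mem (hle x.2) (hle y.2)) h)
  obtain ⟨B, hB⟩ := Finite.surjective_of_injective hinj ⟨P, AddSubgroup.mem_zmultiples P⟩
  exact ⟨B, hle B.2, congrArg Subtype.val hB⟩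

/-! ### `P(1)` is `Gal(K[1]/K)`-invariant and descends to a Heegner point of `E(K)` -/

section Descent

variable {N : ℕ} [NeZero N] {W : WeierstrassCurve ℚ} {K : Type u} [Field K] [NumberField K]
  {Dt : ModularParametrizationData W N} {β : ℤ} {ι : K →+* ℂ}

/-- `G_1 = Gal(K[1]/K[1])` is trivial. [folklore] -/
theorem bottomTorsion_ringClassGalOver_one_one (ι : K →+* ℂ) : ringClassGalOver ι 1 1 = ⊥ := by
  rw [eq_bot_iff]
  intro σ hσ
  rw [ringClassGalOver, mem_fixingSubgroup_iff] at hσ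
  rw [Subgroup.mem_bot]
  exact AlgEquiv.ext fun x ↦ hσ x x.2

/-- At conductor `1` the coset representatives `S` of `G_1 = 1` in `𝒢_1` are all of
`𝒢_1 = Gal(K[1]/K)` (Gross 1991, §4: `P_1 = Σ_{σ ∈ S} σ y_1 = Tr_{K_1/K}(y_1)`). [folklore] -/
theorem bottomTorsion_mem_S_iff (d : KolyvaginHeegnerData Dt β ι 1)
    {g : ringClassField K ι 1 ≃ₐ[ℚ] ringClassField K ι 1} : g ∈ d.S ↔ g ∈ ringClassGal ι 1 := by
  refine ⟨d.S_subset g, fun hg ↦ ?_⟩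
  obtain ⟨s, ⟨hsS, hs⟩, -⟩ := d.S_transversal g hg
  rw [bottomTorsion_ringClassGalOver_one_one, Subgroup.mem_bot, inv_mul_eq_one] at hs
  rwa [hs]

/-- **`P(1) = Σ_{σ ∈ 𝒢_1} σ y(1)` is fixed by `𝒢_1 = Gal(K[1]/K)`** (reindex the sum by
`σ ↦ g σ`). [folklore] -/
theorem bottomTorsion_pointGalHom_derivedPoint (d : KolyvaginHeegnerData Dt β ι 1)
    {g : ringClassField K ι 1 ≃ₐ[ℚ] ringClassField K ι 1} (hg : g ∈ ringClassGal ι 1) :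
    pointGalHom W (ringClassField K ι 1) g d.derivedPoint = d.derivedPoint := by
  rw [d.derivedPoint_one, map_sum]
  refine Finset.sum_nbij' (fun s ↦ g * s) (fun s ↦ g⁻¹ * s) (fun s hs ↦ ?_) (fun s hs ↦ ?_)
    (fun s _ ↦ inv_mul_cancel_left g s) (fun s _ ↦ mul_inv_cancel_left g s) (fun s _ ↦ ?_)
  · exact (bottomTorsion_mem_S_iff d).mpr (mul_mem hg ((bottomTorsion_mem_S_iff d).mp hs))
  · exact (bottomTorsion_mem_S_iff d).mpr
      (mul_mem (inv_mem hg) ((bottomTorsion_mem_S_iff d).mp hs))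
  · rw [map_mul]
    rfl

/-- The coordinatewise action of `σ ∈ Gal(K[1]/K)` on `E(K[1])` is that of `σ` viewed in
`Aut(K[1]/ℚ)` (`pointGalHom`). [folklore] -/
theorem bottomTorsion_map_restrictScalars
    (σ : ringClassField K ι 1 ≃ₐ[K] ringClassField K ι 1)
    (P : (W.baseChange (ringClassField K ι 1)).toAffine.Point) :
    WeierstrassCurve.Affine.Point.map (W' := W)
        (σ : ringClassField K ι 1 →ₐ[K] ringClassField K ι 1) P =
      pointGalHom W (ringClassField K ι 1) (σ.restrictScalars ℚ) P := by
  cases P <;> rfl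

/-- **`P(1)` descends to `E(K)`**: `P(1) = Tr_{K[1]/K} y(1)` is fixed by `Gal(K[1]/K)` (`K[1]/K`
is Galois: `finiteDimensional_and_isGalois_ringClassField`), hence is the image of a point of
`E(K)` (Galois descent, `exists_map_eq_of_forall_map_galois_eq`) — *"`y_K = Tr_{K_1/K}(y_1)` in
`E(K)` … obtained by adding `y_1` to its conjugates"* (Gross 1991, §1).
[cite: GrossLMS1991, §1 (p. 236) and §4 (P_1 = y_K)] -/
theorem bottomTorsion_exists_map_eq_derivedPoint (hK : IsImaginaryQuadratic K)
    (d : KolyvaginHeegnerData Dt β ι 1) :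
    ∃ P₀ : (W.baseChange K).toAffine.Point,
      WeierstrassCurve.Affine.Point.map (algebraMap K (ringClassField K ι 1)).toRatAlgHom P₀ =
        d.derivedPoint := by
  haveI := (finiteDimensional_and_isGalois_ringClassField hK ι one_ne_zero).2
  refine exists_map_eq_of_forall_map_galois_eq W fun σ ↦ ?_
  have hσ : σ.restrictScalars ℚ ∈ ringClassGal ι 1 := by
    rw [ringClassGal, mem_fixingSubgroup_iff]
    rintro x ⟨k, hk⟩
    have hx : x = algebraMap K (ringClassField K ι 1) k := Subtype.ext hk.symm
    rw [hx, AlgEquiv.smul_def, AlgEquiv.restrictScalars_apply]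
    exact σ.commutes k
  exact (bottomTorsion_map_restrictScalars σ d.derivedPoint).trans
    (bottomTorsion_pointGalHom_derivedPoint d hσ)

/-- **The descended point `P(1) ∈ E(K)` is a Heegner point of level `N`** (`IsHeegnerPoint`),
granted Shimura reciprocity at conductor `1` (`heegnerPointOfConductor_one_galoisConj`): under `ι`
it maps to `Σ_{s ∈ S} (s y(1))_ℂ = Σ_{Q ∈ H.reps} φ(τ_Q) = heegnerPointComplex Dt H` for a Heegner
datum `H` of discriminant `d_K` with residue `β` (which exists, `exists_heegnerDatum`) — Gross 1991,
§4: `P_1 = y_K`. [cite: GrossLMS1991, §4 (P_1 = y_K)] [cite: Darmon2004, Thm. 3.7 and §3.7 (PDF pp. 44, 49)] -/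
theorem bottomTorsion_isHeegnerPoint [W.IsElliptic]
    (hrec : heegnerPointOfConductor_one_galoisConj N W K) (hK : IsImaginaryQuadratic K)
    (hH : SatisfiesHeegnerHypothesis N K) (d : KolyvaginHeegnerData Dt β ι 1)
    {P₀ : (W.baseChange K).toAffine.Point}
    (hP₀ : WeierstrassCurve.Affine.Point.map (algebraMap K (ringClassField K ι 1)).toRatAlgHom P₀ =
      d.derivedPoint) :
    IsHeegnerPoint N W K P₀ := by
  obtain ⟨H, hHβ⟩ := exists_heegnerDatum N hK.discr_neg d.dvd_sq_sub
  obtain ⟨e, he⟩ := hrec hK hH Dt β ι d H hHβ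
  refine ⟨Dt, H, ι, ?_⟩
  have hι : ι.toRatAlgHom = (ringClassField K ι 1).subtype.toRatAlgHom.comp
      (algebraMap K (ringClassField K ι 1)).toRatAlgHom := by
    ext x
    rfl
  rw [hι, ← WeierstrassCurve.Affine.Point.map_map, hP₀, d.derivedPoint_one, map_sum,
    heegnerPointComplex, ← Finset.sum_coe_sort H.reps, ← Finset.sum_coe_sort d.S]
  exact Fintype.sum_equiv e _ _ fun s ↦ he s

end Descent

/-! ### The stub, relative to the named facts -/

/-- **Stub HG (`stub_heegner_bottom_torsion`) of line `heegner_order`, closed MODULO the named facts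
`analyticRankEK_eq_add` (`ord_{s=1} L(E/K, s) = r_an(E) + r_an(E^{(d_K)})`, Gross–Zagier 1986 I.§7),
`analyticRankEK_eq_one_iff_heegner_nonTorsion` (`ord_{s=1} L(E/K, s) = 1 ↔ P_K` non-torsion,
Gross–Zagier 1986 Thm. I.6.3 with V.§2) and `heegnerPointOfConductor_one_galoisConj` (Shimura
reciprocity at conductor `1`: `P(1) = Tr_{K[1]/K} y(1) = y_K` is the Gross–Zagier point; Darmon 2004
Thm. 3.7, Gross 1991 §4).** Behind the three (∀-closed) hypotheses the conclusion is the registered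
signature verbatim: for globally minimal elliptic `W/ℚ`, `p ≥ 5` good ordinary with `ρ̄_{E,p}` onto,
`K` imaginary quadratic with `d_K ∉ {−3, −4}`, `p ∤ d_K`, the Heegner hypothesis for `N_E` and
`r_an(E) + r_an(E^{(d_K)}) ≥ 2`, every bottom class `c_M(1) = d.kolyvaginClass hp.out M` vanishes.
Proof: `ord_{s=1} L(E/K, s) ≥ 2 ≠ 1`; `P(1)` is `Gal(K[1]/K)`-invariant (`S = 𝒢_1` since `G_1 = 1`)
and descends to `P₀ ∈ E(K)` (`bottomTorsion_exists_map_eq_derivedPoint`), a Heegner point of level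
`N_E` by reciprocity (`bottomTorsion_isHeegnerPoint`), hence torsion by Gross–Zagier; so
`P = P(1) ∈ A = E(K[1]) ⊆ E(K̄)` is torsion; on the admissible branch of `kolyvaginClass` (`[p^M]`
injective on `A`) `P ∈ p^M A` (`bottomTorsion_exists_zsmul_eq`), so McCallum's class vanishes
(`kolyvaginClass_eq_cls`, `KolyvaginCocycle.cls_eq_zero_of_mem`: Gross 1991 Prop. 4.7 (1)); off it
the class is `0` by definition. CONDITIONAL; it does not close the stub.
[cite: GrossZagier1986, Thm. I.6.3 with V.§2] [cite: GrossLMS1991, §4 (4.1), Prop. 4.7 (1)]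
[cite: Darmon2004, Thm. 3.7 (PDF p. 44)] [cite: WZhang2014, proof of Thm. 1.3 (p. 196)] -/
theorem stub_heegner_bottom_torsion_of_facts :
    (∀ (W : WeierstrassCurve ℚ) (K : Type) [Field K] [NumberField K], analyticRankEK_eq_add W K) →
    (∀ (W : WeierstrassCurve ℚ) (N : ℕ) [NeZero N] (K : Type) [Field K] [NumberField K],
        analyticRankEK_eq_one_iff_heegner_nonTorsion W N K) →
    (∀ (N : ℕ) [NeZero N] (W : WeierstrassCurve ℚ) (K : Type) [Field K] [NumberField K],
        heegnerPointOfConductor_one_galoisConj N W K) →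
    ∀ (W : WeierstrassCurve ℚ) [W.IsElliptic] [W.IsGloballyMinimal] (p : ℕ) [hp : Fact p.Prime],
      5 ≤ p → W.HasGoodReductionAtPrime p → ¬ (p : ℤ) ∣ W.frobeniusTrace p →
      W.HasSurjectiveModNGaloisRep p →
      ∀ (K : Type) [Field K] [NumberField K], IsImaginaryQuadratic K →
        NumberField.discr K ≠ -3 → NumberField.discr K ≠ -4 → ¬ ((p : ℤ) ∣ NumberField.discr K) →
        ∀ [NeZero (W.conductorNorm ℤ)], SatisfiesHeegnerHypothesis (W.conductorNorm ℤ) K →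
        2 ≤ W.analyticRank + (W.quadraticTwist (NumberField.discr K : ℚ)).analyticRank →
        ∀ (Dt : ModularParametrizationData W (W.conductorNorm ℤ)) (β : ℤ) (ι : K →+* ℂ)
          (d : KolyvaginHeegnerData Dt β ι 1) (M : ℕ),
          d.kolyvaginClass hp.out M = 0 := by
  intro hadd hGZ hrec W _ _ p hp _ _ _ _ K _ _ hK _ _ _ _ hH h2 Dt β ι d M
  -- `ord_{s=1} L(E/K, s) = r_an(E) + r_an(E^{(d_K)}) ≥ 2`, so it is not `1`
  have hne : analyticRankEK W K ≠ 1 := by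
    rw [hadd W K]
    omega
  -- `P(1) = y_K ∈ E(K)` is a Heegner point of level `N_E`, hence torsion by Gross–Zagier
  obtain ⟨P₀, hP₀⟩ := bottomTorsion_exists_map_eq_derivedPoint hK d
  have hheeg : IsHeegnerPoint (W.conductorNorm ℤ) W K P₀ :=
    bottomTorsion_isHeegnerPoint (hrec _ W K) hK hH d hP₀
  have htors : IsOfFinAddOrder P₀ := by
    by_contra hnt
    exact hne ((hGZ W (W.conductorNorm ℤ) K hK rfl hH hheeg).mpr hnt)
  have hfin : IsOfFinAddOrder (d.toGeomPoints d.derivedPoint) := by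
    rw [← hP₀]
    exact d.toGeomPoints.isOfFinAddOrder
      ((WeierstrassCurve.Affine.Point.map (W' := W)
        (algebraMap K (ringClassField K ι 1)).toRatAlgHom).isOfFinAddOrder htors)
  -- McCallum's class of a `p^M`-divisible point of `A = E(K[1])` vanishes; off the admissible
  -- branch the class is `0` by definition
  rw [KolyvaginHeegnerData.kolyvaginClass]
  split_ifs with h
  · obtain ⟨B, hBA, hB⟩ := bottomTorsion_exists_zsmul_eq h.1.eq_zero_of_zsmul
      (AddMonoidHom.mem_range.mpr ⟨d.derivedPoint, rfl⟩) hfin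
    rw [kolyvaginClass_eq_cls h.1 h.2 hB]
    exact KolyvaginCocycle.cls_eq_zero_of_mem h.1 _ h.2 hB ⟨B, hBA, hB⟩
  · rfl

/-- **Stub HG relative to the Modularity theorem, the Gross–Zagier formula and Shimura
reciprocity at conductor `1`.** Same conclusion (the registered signature verbatim) behind
`exists_isNewformOf` (every elliptic `E/ℚ` has a newform of level `N_E`: Breuil–Conrad–Diamond–Taylor
2001, Thm. A, with Carayol), `gross_zagier N W K` (Gross–Zagier 1986, Thm. I.6.3; Yuan–Zhang–Zhang
2013, Thm. 1.2) and `heegnerPointOfConductor_one_galoisConj N W K` (Darmon 2004, Thm. 3.7): the two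
Gross–Zagier-type facts of `stub_heegner_bottom_torsion_of_facts` are consequences of the first two
by the tree's proved `analyticRankEK_eq_add_of` (orders of entire functions add; entire continuation
`WeierstrassCurve.hasEntireLFunction_rat_of_exists_isNewformOf`) and
`analyticRankEK_eq_one_iff_heegner_nonTorsion_of_exists_isNewformOf` (sign `−1` under the Heegner
hypothesis + simple zero iff `L' ≠ 0` + Gross–Zagier + `ĥ(P) = 0 ↔ P` torsion). CONDITIONAL; it does
not close the stub. [cite: GrossZagier1986, Thm. I.6.3 with V.§2] [cite: BCDTJAMS2001, Thm. A]
[cite: Darmon2004, Thm. 3.7 (PDF p. 44)] -/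
theorem stub_heegner_bottom_torsion_of_modularity :
    exists_isNewformOf →
    (∀ (N : ℕ) [NeZero N] (W : WeierstrassCurve ℚ) (K : Type) [Field K] [NumberField K],
        gross_zagier N W K) →
    (∀ (N : ℕ) [NeZero N] (W : WeierstrassCurve ℚ) (K : Type) [Field K] [NumberField K],
        heegnerPointOfConductor_one_galoisConj N W K) →
    ∀ (W : WeierstrassCurve ℚ) [W.IsElliptic] [W.IsGloballyMinimal] (p : ℕ) [hp : Fact p.Prime],
      5 ≤ p → W.HasGoodReductionAtPrime p → ¬ (p : ℤ) ∣ W.frobeniusTrace p →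
      W.HasSurjectiveModNGaloisRep p →
      ∀ (K : Type) [Field K] [NumberField K], IsImaginaryQuadratic K →
        NumberField.discr K ≠ -3 → NumberField.discr K ≠ -4 → ¬ ((p : ℤ) ∣ NumberField.discr K) →
        ∀ [NeZero (W.conductorNorm ℤ)], SatisfiesHeegnerHypothesis (W.conductorNorm ℤ) K →
        2 ≤ W.analyticRank + (W.quadraticTwist (NumberField.discr K : ℚ)).analyticRank →
        ∀ (Dt : ModularParametrizationData W (W.conductorNorm ℤ)) (β : ℤ) (ι : K →+* ℂ)
          (d : KolyvaginHeegnerData Dt β ι 1) (M : ℕ),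
          d.kolyvaginClass hp.out M = 0 :=
  fun hmod hGZ hrec ↦ stub_heegner_bottom_torsion_of_facts
    (fun W K _ _ ↦ by
      intro _
      exact analyticRankEK_eq_add_of
        (WeierstrassCurve.hasEntireLFunction_rat_of_exists_isNewformOf hmod) W K)
    (fun W N _ K _ _ ↦
      analyticRankEK_eq_one_iff_heegner_nonTorsion_of_exists_isNewformOf W N K (hGZ N W K) hmod)
    hrec

end Summit.BirchSwinnertonDyer.BirchSwinnertonDyer.Theorems

end
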